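import Summits.BirchSwinnertonDyer.BirchSwinnertonDyer.Theorems.ThetaPartnerAtTwoSignedKatoUpToAtTwoLocalTwoCyclotomicTower
import Summits.BirchSwinnertonDyer.BirchSwinnertonDyer.Theorems.ThetaPartnerAtTwoSignedKatoUpToAtTwoLocalTwoLayerTorsion
import Summits.BirchSwinnertonDyer.Rank1Residual.Additive.CyclotomicTowerSignedLocalIntersection
import Summits.BirchSwinnertonDyer.Rank1Residual.Additive.KobayashiSignedGenerationOfStab
import HarnessLib

/-!
# Route `ThetaPartnerAtTwo` (TP2), crux K3 `SignedKatoDivisibilityUpToAtTwo` (item stmt-BirchSwinnertonDyer-20308),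
# line `colemanrat` v3 — THE LOCAL THEORY AT `p = 2`, file 12: Kobayashi's Prop. 8.12 ii), FIRST identity
# (DIRECTNESS) `E⁺(K_{n,v}) ∩ E⁻(K_{n,v}) = E(ℚ₂)` AT `p = 2` along the μ-tower `K_{n,v} = ℚ₂(ζ_{2^{n+1}})`
# (towers with local stabilisers — the `hU` shape of files 7/10), and the full exact sequence (8.22) at `p = 2`

HONEST FRAMING (cell `bsd-wall`, width seat `bsd-wall-tp2-p2x-w2` g2): THEOREMS ONLY — no definition, no named fact,
no instance, no `sorry`; local theory of the signed (`±`) point groups; nothing about any Selmer group is asserted;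
closes no item; BSD is NOT proved by any of this. The `ℤ_p`-tower twin (Def. 1.1's `signedLocalPointsOfEmb κ ι W (±1) n`,
K3's own object) is the sibling file 11 `…LocalTwoSignedIntersection` (width seat `w3` g2) and is NOT restated here.

## Source (S. Kobayashi, Invent. Math. 152 (2003), p. 18, proof of Prop. 8.12, first paragraph)

"We first show that `C_ss(m_n) ∩ C_ss(m_{n−1}) = F_ss(m_{−1})`. Let `P ∈ C_ss(m_n) ∩ C_ss(m_{n−1})`. We show that
if `P ∈ F_ss(m_m)` then `P ∈ F_ss(m_{m−1})`. Suppose that `n ≡ m − 1 mod 2`. Then by the definition of `C_ss(m_n)`,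
we have `p^{n−m} P = Tr^{ss}_{n/m} P ∈ F_ss(m_{m−1})`. Therefore for `σ ∈ Gal(k_m/k_{m−1})`, we have
`p^{n−m}(P^σ − P) = 0`. Hence, by Proposition 8.7, `P ∈ F_ss(m_{m−1})`." — NO rank count: the only inputs are
(i) no `p`-power torsion in `E(K_{n,v})` (Prop. 8.7) and (ii) the layer indices `[K_{n,v} : K_{m,v}]` are `p`-powers.
The tree proves exactly this descent for ANY `q` (`inf_towerSignedLocalPointsOfEmb_eq_top`, cell `b2b-bsdres`, with
hypotheses `htors`, `hidx`; its `towerSubgroup κ K₀` instance is `inf_towerSigned_towerSubgroup_eq_top`); this file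
DISCHARGES both hypotheses for the `hU`-towers of the lead's files 7/10 (`(U n)_{ℚ_p} = Stab ζ_{p^{n+1}}`) — `hidx` at every
prime (`index_subgroupOf_stab_succ_dvd_pow`), `htors` at `p = 2` by the lead's Prop. 8.7 at `2` (file 8's
`eq_zero_of_two_pow_smul_eq_zero_of_forall_smul_eq`: `3 ∣ deg x(P)` on `E[2] ∖ O`), in K3's binders (`W/ℚ` globally
minimal, `GoodSS W 2`; NO `a₂ = 0` needed for directness).

## What is proved

* §1 (every prime) `inf_towerSigned_eq_localFixedPointsOfEmb_top_of_stab`: along any tower `U` of normal finite-index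
  subgroups of `Γ_K` with LOCAL subgroups `(U n)_{ℚ_p} = Stab ζ_{p^{n+1}}`: no `p`-torsion in `E(K_{n,v})` ⟹
  `E⁺(K_{n,v}) ⊓ E⁻(K_{n,v}) = E(K_{−1,v})` (`localFixedPointsOfEmb ι W ⊤ = E(ℚ_p)`).
* §2 (`p = 2`, `W/ℚ` globally minimal, `GoodSS W 2`) `eq_zero_of_two_pow_smul_eq_zero_localFixedPointsOfEmb_of_stab`
  (Prop. 8.7 at `2` on `E(ℚ₂(ζ_{2^{n+1}}))` in the tower vocabulary: index `φ(2^{n+1}) = 2ⁿ`, prime to `3`),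
  **`inf_towerSigned_eq_localFixedPointsOfEmb_top_two_of_stab`** — `E⁺(K_{n,v}) ⊓ E⁻(K_{n,v}) = E(ℚ₂)` UNCONDITIONALLY for
  every such tower, `inf_towerSigned_eq_localFixedPointsOfEmb_top_two_cyclotomic` (Kobayashi's own tower
  `U n = Gal(ℚ̄/ℚ(ζ_{2^{n+1}}))` of file 10), and with file 10's generation half **`towerSigned_exact_two_cyclotomic`**: BOTH
  identities of Prop. 8.12 ii) AT `p = 2` in the source's setting (`a₂(W) = 0` for the generation half only) — the
  exact sequence (8.22) `0 → E(ℚ₂) → E⁺(K_{n,v}) ⊕ E⁻(K_{n,v}) → E(K_{n,v}) → 0` along `ℚ₂(μ_{2^∞})`, every `n`, every `ι`.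

Not here: the `ℤ₂`-tower (file 11), the real layers `ℚ_{2,n} ⊂ K_{n+1,v}` (the sign-flip dictionary is the sequel),
the Coleman maps, anything global.

References: [Kobayashi2003] §2 p. 4, Prop. 8.7 (p. 16), Prop. 8.12 ii) + proof (pp. 17–18), (8.22);
[KuriharaOtsuki2006] p. 557 (the `p = 2`, `a₂ = 0` case asserted); [SerreLocalFields1979] Ch. IV §4 (the indices).
-/

set_option autoImplicit false
-- the Theorems namespace of this sub repeats the summit name by design (D-0017 nested layout)
set_option linter.dupNamespace false

noncomputable section

open scoped Classical

namespace Summit.BirchSwinnertonDyer.BirchSwinnertonDyer.Theorems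

namespace SignedKatoOffTwo.LocalTwo

open Literature.NumberTheory.EllipticCurves Literature.NumberTheory.GaloisRepresentations WeierstrassCurve Field
open Summit.BirchSwinnertonDyer.Rank1Residual.Additive
open Summit.BirchSwinnertonDyer.Rank1Residual.Additive.PadicCyclotomicTower
open Literature.NumberTheory.EllipticCurves.Rank1Residual

/-! ## §1 Prop. 8.12 ii), first identity, along a tower with local stabilisers — every prime, modulo Prop. 8.7 -/

section AllPrimes

variable {p : ℕ} [hp : Fact p.Prime] {K : Type} [Field K] [Algebra K ℚ_[p]]
  (ι : AlgebraicClosure K →ₐ[K] AlgebraicClosure ℚ_[p]) (W : WeierstrassCurve K)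
  (U : ℕ → Subgroup (Field.absoluteGaloisGroup K)) [hUf : ∀ n, (U n).FiniteIndex] [hUN : ∀ n, (U n).Normal]

/-- **Kobayashi's Prop. 8.12 ii), first identity, at EVERY prime, modulo Prop. 8.7**: for a tower `U` of normal
finite-index subgroups of `Γ_K` whose LOCAL subgroups at `ι : K̄ → ℚ̄_p` are the stabilisers `Stab ζ_{p^{n+1}}`
(`K_{n,v} = ℚ_p(ζ_{p^{n+1}})`), if `E(K_{n,v})` has no `p`-torsion then
`E⁺(K_{n,v}) ⊓ E⁻(K_{n,v}) = E(K_{−1,v})` (`= localFixedPointsOfEmb ι W ⊤ = E(ℚ_p)`). The tree's any-`q` descent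
`inf_towerSignedLocalPointsOfEmb_eq_top` with its index hypothesis discharged by the tree's `index_subgroupOf_stab_succ_dvd_pow` (`[K_{n,v} : K_{m,v}] = p^{n−m}`).
[cite: Kobayashi2003, Prop. 8.12 ii) + proof (pp. 17–18), Def. 8.16 (p. 19)] -/
theorem inf_towerSigned_eq_localFixedPointsOfEmb_top_of_stab
    (hU : ∀ n, localSubgroupOfEmb (U n) ι = stab p (n + 1)) (n : ℕ)
    (htors : ∀ Q ∈ localFixedPointsOfEmb ι W (U n), p • Q = 0 → Q = 0) :
    towerSignedLocalPointsOfEmb U ι W 1 n ⊓ towerSignedLocalPointsOfEmb U ι W (-1) n =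
      localFixedPointsOfEmb ι W ⊤ :=
  inf_towerSignedLocalPointsOfEmb_eq_top U ι W n htors fun m hm =>
    ⟨n, by rw [hU n, hU m]; exact index_subgroupOf_stab_succ_dvd_pow hm⟩

end AllPrimes

/-! ## §2 `p = 2`: directness along `ℚ₂(μ_{2^∞})` UNCONDITIONALLY in K3's binders -/

section Two

variable (W : WeierstrassCurve ℚ) [W.IsGloballyMinimal] (ι : AlgebraicClosure ℚ →ₐ[ℚ] AlgebraicClosure ℚ_[2])

/-- **Prop. 8.7 AT `p = 2` on `E(ℚ₂(ζ_{2^{n+1}}))` in the tower vocabulary**: for `W/ℚ` globally minimal with `GoodSS W 2`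
and a tower `U` with local subgroups `Stab ζ_{2^{n+1}}`, the group `E(K_{n,v}) = localFixedPointsOfEmb ι W (U n)` has NO
`2`-power torsion — its fixing group has index `φ(2^{n+1}) = 2ⁿ`, non-zero and prime to `3` (file 8's
`eq_zero_of_two_pow_smul_eq_zero_of_forall_smul_eq`: `3 ∣ deg x(P)` for `P ∈ E[2] ∖ O`). [cite: Kobayashi2003, Prop. 8.7 (p. 16)] -/
theorem eq_zero_of_two_pow_smul_eq_zero_localFixedPointsOfEmb_of_stab (hss : GoodSS W 2)
    {U : ℕ → Subgroup (Field.absoluteGaloisGroup ℚ)}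
    (hU : ∀ n, localSubgroupOfEmb (U n) ι = stab 2 (n + 1)) (n : ℕ) {P : localPoints W ℚ_[2]}
    (hP : P ∈ localFixedPointsOfEmb ι W (U n)) {k : ℕ} (hk : 2 ^ k • P = 0) : P = 0 := by
  have hidx : (localSubgroupOfEmb (U n) ι).index = 2 ^ n := by
    rw [hU n, index_stab', Nat.totient_prime_pow_succ Nat.prime_two]
    norm_num
  refine eq_zero_of_two_pow_smul_eq_zero_of_forall_smul_eq W hss (localSubgroupOfEmb (U n) ι) ?_ ?_
    ((mem_localFixedPointsOfEmb_iff ι W (U n) P).mp hP) hk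
  · rw [hidx]; exact pow_ne_zero n two_ne_zero
  · rw [hidx]
    intro h3
    have := Nat.Prime.dvd_of_dvd_pow Nat.prime_three h3
    omega

/-- **Kobayashi's Prop. 8.12 ii), first identity, AT `p = 2`, UNCONDITIONALLY**: for `W/ℚ` globally minimal with
`GoodSS W 2`, along ANY tower `U` of normal finite-index subgroups of `Γ_ℚ` with local subgroups `Stab ζ_{2^{n+1}}`
(`K_{n,v} = ℚ₂(ζ_{2^{n+1}})`) and any `ι : ℚ̄ → ℚ̄₂`: **`E⁺(K_{n,v}) ⊓ E⁻(K_{n,v}) = E(ℚ₂)`** for every `n` (no `a₂ = 0`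
needed). §1 with `htors` := Prop. 8.7 at `2`. [cite: Kobayashi2003, Prop. 8.12 ii) + proof (pp. 17–18)] [cite: KuriharaOtsuki2006, p. 557] -/
theorem inf_towerSigned_eq_localFixedPointsOfEmb_top_two_of_stab (hss : GoodSS W 2)
    {U : ℕ → Subgroup (Field.absoluteGaloisGroup ℚ)} [∀ n, (U n).FiniteIndex] [∀ n, (U n).Normal]
    (hU : ∀ n, localSubgroupOfEmb (U n) ι = stab 2 (n + 1)) (n : ℕ) :
    towerSignedLocalPointsOfEmb U ι W 1 n ⊓ towerSignedLocalPointsOfEmb U ι W (-1) n =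
      localFixedPointsOfEmb ι W ⊤ :=
  inf_towerSigned_eq_localFixedPointsOfEmb_top_of_stab ι W U hU n fun _ hQ h2 =>
    eq_zero_of_two_pow_smul_eq_zero_localFixedPointsOfEmb_of_stab W ι hss hU n hQ (k := 1) (by rwa [pow_one])

/-- **Directness AT `p = 2` along Kobayashi's own tower `U n = Gal(ℚ̄/ℚ(ζ_{2^{n+1}}))`** (stabilisers in `Γ_ℚ` of any family
`z n ∈ ℚ̄` of primitive `2^{n+1}`-th roots; local subgroups `Stab ζ_{2^{n+1}}` by file 10's `localSubgroupOfEmb_stabilizer_eq_stab`):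
`E⁺(ℚ₂(ζ_{2^{n+1}})) ⊓ E⁻(ℚ₂(ζ_{2^{n+1}})) = E(ℚ₂)`, `W/ℚ` globally minimal with `GoodSS W 2`, every `n`, every `ι`.
[cite: Kobayashi2003, Prop. 8.12 ii) (p. 17)] -/
theorem inf_towerSigned_eq_localFixedPointsOfEmb_top_two_cyclotomic (hss : GoodSS W 2)
    {z : ℕ → AlgebraicClosure ℚ} (hz : ∀ n, IsPrimitiveRoot (z n) (2 ^ (n + 1)))
    [hUf : ∀ n, (MulAction.stabilizer (absoluteGaloisGroup ℚ) (z n)).FiniteIndex]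
    [hUN : ∀ n, (MulAction.stabilizer (absoluteGaloisGroup ℚ) (z n)).Normal] (n : ℕ) :
    towerSignedLocalPointsOfEmb (fun k => MulAction.stabilizer (absoluteGaloisGroup ℚ) (z k)) ι W 1 n ⊓
        towerSignedLocalPointsOfEmb (fun k => MulAction.stabilizer (absoluteGaloisGroup ℚ) (z k)) ι W (-1) n =
      localFixedPointsOfEmb ι W ⊤ :=
  inf_towerSigned_eq_localFixedPointsOfEmb_top_two_of_stab W ι hss
    (U := fun k => MulAction.stabilizer (absoluteGaloisGroup ℚ) (z k))
    (fun k => localSubgroupOfEmb_stabilizer_eq_stab 2 ι (hz k)) n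

/-- **KOBAYASHI's Prop. 8.12 ii) AT `p = 2`, BOTH identities, in the source's setting** — the exact sequence (8.22)
`0 → E(ℚ₂) → E⁺(K_{n,v}) ⊕ E⁻(K_{n,v}) → E(K_{n,v}) → 0` along `K_{n,v} = ℚ₂(ζ_{2^{n+1}})` as the pair of lattice identities
`E⁺ ⊔ E⁻ = E(K_{n,v})` (generation: file 10, needs `a₂(W) = 0`) and `E⁺ ⊓ E⁻ = E(ℚ₂)` (directness: this file), for every
globally minimal `W/ℚ` with `GoodSS W 2`, `a₂(W) = 0`, every `n`, every `ι : ℚ̄ → ℚ̄₂`. [cite: Kobayashi2003, Prop. 8.12 ii) and (8.22) (p. 17)]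
[cite: KuriharaOtsuki2006, p. 557] -/
theorem towerSigned_exact_two_cyclotomic [W.IsElliptic] (hss : GoodSS W 2) (ha : W.frobeniusTrace 2 = 0)
    {z : ℕ → AlgebraicClosure ℚ} (hz : ∀ n, IsPrimitiveRoot (z n) (2 ^ (n + 1)))
    [hUf : ∀ n, (MulAction.stabilizer (absoluteGaloisGroup ℚ) (z n)).FiniteIndex]
    [hUN : ∀ n, (MulAction.stabilizer (absoluteGaloisGroup ℚ) (z n)).Normal] (n : ℕ) :
    towerSignedLocalPointsOfEmb (fun k => MulAction.stabilizer (absoluteGaloisGroup ℚ) (z k)) ι W 1 n ⊔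
          towerSignedLocalPointsOfEmb (fun k => MulAction.stabilizer (absoluteGaloisGroup ℚ) (z k)) ι W (-1) n =
        localFixedPointsOfEmb ι W (MulAction.stabilizer (absoluteGaloisGroup ℚ) (z n)) ∧
      towerSignedLocalPointsOfEmb (fun k => MulAction.stabilizer (absoluteGaloisGroup ℚ) (z k)) ι W 1 n ⊓
          towerSignedLocalPointsOfEmb (fun k => MulAction.stabilizer (absoluteGaloisGroup ℚ) (z k)) ι W (-1) n =
        localFixedPointsOfEmb ι W ⊤ :=
  ⟨sup_towerSigned_eq_localFixedPointsOfEmb_two_cyclotomic W hss ha ι hz n,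
    inf_towerSigned_eq_localFixedPointsOfEmb_top_two_cyclotomic W ι hss hz n⟩

end Two

end SignedKatoOffTwo.LocalTwo

end Summit.BirchSwinnertonDyer.BirchSwinnertonDyer.Theorems

end
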